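import Mathlib
import Literature.Analysis.FluidPDE.SelfSimilar
import Literature.Analysis.FluidPDE.PoincareBall
import HarnessLib

/-!
# Crux `RecurrentLiouville` (stmt-NavierStokesRegularity-1589), line `Sketch` (skeleton v6, Giga–Kohn harvest) —
# stub `stub_gkScalingCurve`: the scaling curve, FTC + Cauchy–Schwarz

Theorems-only file (no definitions, no named facts): the pointwise calculus step of the
Giga–Kohn-metric harvest (no PDE).  For a field `u : ℝ → E → F` of class `C¹` on the open
backward slab `S = (-∞, 0) × E`, a time `t < 0`, a point `x` and a scale factor `c ≥ 1`, the
SCALING CURVE `γ(ς) = ς u(ς²t, ςx) = (nsRescale ς u)(t, x)` has, at every `ς > 0`, the derivative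
`γ'(ς) = u(τ, y) + D(uncurry u)(τ, y)[(2τ, y)]` at `(τ, y) = (ς²t, ςx)` (chain rule for
`ς ↦ (ς²t, ςx)`, whose velocity is `(2ςt, x) = ς⁻¹ (2τ, y)`, and the product rule;
`gkCurve_hasDerivAt`); this velocity field is continuous on `(0, ∞)` (`gkCurve_continuousOn_deriv`).
Hence the fundamental theorem of calculus on `[1, c]` and the Cauchy–Schwarz inequality
`(∫_{[1,c]} ‖γ'‖)² ≤ (c − 1) ∫_{[1,c]} ‖γ'‖²` (the landed
`PoincareBall.sq_lintegral_le_measure_mul_lintegral_sq`, Hölder with exponents `2, 2` against the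
constant `1`) give
`‖c u(c²t, cx) − u(t, x)‖² ≤ (c − 1) ∫_{[1,c]} ‖γ'(ς)‖² dς`
(`gkCurve_enorm_sq_le`; registered stub `stub_gkScalingCurve` for `E = F = ℝ³`), stated with
extended norms and lower Lebesgue integrals so that no integrability hypothesis is needed.

## References

* Y. Giga, R. V. Kohn, *Asymptotically self-similar blow-up of semilinear heat equations*,
  Comm. Pure Appl. Math. 38 (1985) 297–319 (the scaling action; this file is the elementary
  calculus step along the scaling orbit). [folklore]
-/

noncomputable section

-- the sub-problem namespace repeats the summit name (D-0017 layout `Summit.<S>.<P>.Theorems`)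
set_option linter.dupNamespace false

namespace Summit.NavierStokesRegularity.NavierStokesRegularity.Theorems

open MeasureTheory Set Function Filter Topology TopologicalSpace Metric
open Literature.Analysis Literature.Analysis.FluidPDE
open scoped NNReal ENNReal

/-- **Velocity of the scaling curve.**  For `u` of class `C¹` on the open slab `(-∞,0) × E`,
`t < 0`, `x : E` and `ς > 0`, the curve `σ ↦ σ u(σ²t, σx)` has derivative
`u(τ, y) + D(uncurry u)(τ, y)[(2τ, y)]` at `σ = ς`, where `(τ, y) = (ς²t, ςx)`: the chain rule
for the inner curve `σ ↦ (σ²t, σx)` (velocity `(2ςt, x)`), the product rule, and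
`ς · D(uncurry u)(τ,y)[(2ςt, x)] = D(uncurry u)(τ,y)[(2τ, y)]` by linearity. [folklore] -/
theorem gkCurve_hasDerivAt {E F : Type*} [NormedAddCommGroup E] [NormedSpace ℝ E]
    [NormedAddCommGroup F] [NormedSpace ℝ F] (u : ℝ → E → F)
    (hu : ContDiffOn ℝ 1 (uncurry u) (Iio (0 : ℝ) ×ˢ univ)) {t : ℝ} (ht : t < 0) (x : E)
    {ς : ℝ} (hς : 0 < ς) :
    HasDerivAt (fun σ : ℝ => σ • u (σ ^ 2 * t) (σ • x))
      (u (ς ^ 2 * t) (ς • x) +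
        fderiv ℝ (uncurry u) (ς ^ 2 * t, ς • x) (2 * (ς ^ 2 * t), ς • x)) ς := by
  have hS : IsOpen (Iio (0 : ℝ) ×ˢ (univ : Set E)) := isOpen_Iio.prod isOpen_univ
  have hmem : ((ς ^ 2 * t, ς • x) : ℝ × E) ∈ Iio (0 : ℝ) ×ˢ (univ : Set E) :=
    ⟨mul_neg_of_pos_of_neg (pow_pos hς 2) ht, mem_univ _⟩
  -- `uncurry u` is Fréchet differentiable at the point of the open slab
  have hdiff : HasFDerivAt (uncurry u) (fderiv ℝ (uncurry u) (ς ^ 2 * t, ς • x))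
      (ς ^ 2 * t, ς • x) :=
    (hu.differentiableOn_one.differentiableAt (hS.mem_nhds hmem)).hasFDerivAt
  -- the inner curve `σ ↦ (σ²t, σx)` and its velocity
  have hΦ : HasDerivAt (fun σ : ℝ => ((σ ^ 2 * t, σ • x) : ℝ × E)) (2 * ς * t, x) ς := by
    refine HasDerivAt.prodMk ?_ ?_
    · have h : HasDerivAt (fun σ : ℝ => σ ^ 2 * t) (((2 : ℕ) : ℝ) * ς ^ (2 - 1) * t) ς :=
        (hasDerivAt_pow 2 ς).mul_const t
      refine h.congr_deriv ?_
      norm_num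
    · have h : HasDerivAt (fun σ : ℝ => σ • x) ((1 : ℝ) • x) ς :=
        (hasDerivAt_id' (x := ς)).smul_const x
      refine h.congr_deriv ?_
      rw [one_smul]
  -- chain rule: `σ ↦ uncurry u (σ²t, σx)`
  have hcomp := hdiff.comp_hasDerivAt ς hΦ
  -- product rule (`uncurry u ∘ (σ ↦ (σ²t, σx))` is definitionally `σ ↦ u (σ²t) (σx)`)
  have key : HasDerivAt (fun σ : ℝ => σ • u (σ ^ 2 * t) (σ • x))
      (ς • fderiv ℝ (uncurry u) (ς ^ 2 * t, ς • x) (2 * ς * t, x) +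
        (1 : ℝ) • u (ς ^ 2 * t) (ς • x)) ς := by
    have h := (hasDerivAt_id' (x := ς)).smul hcomp
    exact h
  refine key.congr_deriv ?_
  -- linearity: `ς • L (2ςt, x) = L (2ς²t, ςx)`
  have hvec : ς • ((2 * ς * t, x) : ℝ × E) = (2 * (ς ^ 2 * t), ς • x) := by
    rw [Prod.smul_mk, smul_eq_mul, Prod.mk.injEq]
    exact ⟨by ring, rfl⟩
  rw [one_smul, ← hvec, map_smul, add_comm]

/-- **Continuity of the velocity of the scaling curve.**  For `u` of class `C¹` on the open slab
`(-∞,0) × E`, `t < 0` and `x : E`, the velocity field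
`ς ↦ u(ς²t, ςx) + D(uncurry u)(ς²t, ςx)[(2ς²t, ςx)]` is continuous on `(0, ∞)`: `uncurry u` and
`fderiv ℝ (uncurry u)` are continuous on the open slab (`ContDiffOn.continuousOn_fderiv_of_isOpen`),
and `ς ↦ (ς²t, ςx)` maps `(0, ∞)` continuously into it. [folklore] -/
theorem gkCurve_continuousOn_deriv {E F : Type*} [NormedAddCommGroup E] [NormedSpace ℝ E]
    [NormedAddCommGroup F] [NormedSpace ℝ F] (u : ℝ → E → F)
    (hu : ContDiffOn ℝ 1 (uncurry u) (Iio (0 : ℝ) ×ˢ univ)) {t : ℝ} (ht : t < 0) (x : E) :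
    ContinuousOn (fun ς : ℝ => u (ς ^ 2 * t) (ς • x) +
        fderiv ℝ (uncurry u) (ς ^ 2 * t, ς • x) (2 * (ς ^ 2 * t), ς • x)) (Ioi 0) := by
  have hS : IsOpen (Iio (0 : ℝ) ×ˢ (univ : Set E)) := isOpen_Iio.prod isOpen_univ
  have hΦc : Continuous (fun ς : ℝ => ((ς ^ 2 * t, ς • x) : ℝ × E)) := by fun_prop
  have hmaps : MapsTo (fun ς : ℝ => ((ς ^ 2 * t, ς • x) : ℝ × E)) (Ioi 0)
      (Iio (0 : ℝ) ×ˢ (univ : Set E)) :=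
    fun ς hς => ⟨mul_neg_of_pos_of_neg (pow_pos hς 2) ht, mem_univ _⟩
  have h1 : ContinuousOn (fun ς : ℝ => u (ς ^ 2 * t) (ς • x)) (Ioi 0) :=
    hu.continuousOn.comp hΦc.continuousOn hmaps
  have h2 : ContinuousOn (fun ς : ℝ => fderiv ℝ (uncurry u) (ς ^ 2 * t, ς • x)) (Ioi 0) :=
    (hu.continuousOn_fderiv_of_isOpen hS le_rfl).comp hΦc.continuousOn hmaps
  have h3 : ContinuousOn (fun ς : ℝ => ((2 * (ς ^ 2 * t), ς • x) : ℝ × E)) (Ioi 0) := by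
    fun_prop
  exact h1.add (h2.clm_apply h3)

/-- **Increment along the scaling curve** (general normed spaces).  For `u : ℝ → E → F` of class
`C¹` on the open slab `(-∞,0) × E`, `t < 0`, `x : E` and `c ≥ 1`,
`‖c u(c²t, cx) − u(t, x)‖ₑ² ≤ (c − 1) ∫⁻_{[1,c]} ‖u(ς²t, ςx) + D(uncurry u)(ς²t, ςx)[(2ς²t, ςx)]‖ₑ²`:
the fundamental theorem of calculus along `ς ↦ ς u(ς²t, ςx)` on `[1, c]`
(`gkCurve_hasDerivAt`, `gkCurve_continuousOn_deriv`), `‖∫ g‖ₑ ≤ ∫⁻ ‖g‖ₑ`, and Cauchy–Schwarz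
(`PoincareBall.sq_lintegral_le_measure_mul_lintegral_sq`, `volume [1,c] = c − 1`). [folklore] -/
theorem gkCurve_enorm_sq_le {E F : Type*} [NormedAddCommGroup E] [NormedSpace ℝ E]
    [NormedAddCommGroup F] [NormedSpace ℝ F] [CompleteSpace F] (u : ℝ → E → F)
    (hu : ContDiffOn ℝ 1 (uncurry u) (Iio (0 : ℝ) ×ˢ univ)) {t : ℝ} (ht : t < 0) (x : E)
    {c : ℝ} (hc : 1 ≤ c) :
    ‖nsRescale c u t x - u t x‖ₑ ^ 2 ≤
      ENNReal.ofReal (c - 1) * ∫⁻ ς in Icc (1 : ℝ) c,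
        ‖u (ς ^ 2 * t) (ς • x) +
          fderiv ℝ (uncurry u) (ς ^ 2 * t, ς • x) (2 * (ς ^ 2 * t), ς • x)‖ₑ ^ 2 := by
  -- the velocity of the scaling curve
  set g : ℝ → F := fun ς => u (ς ^ 2 * t) (ς • x) +
    fderiv ℝ (uncurry u) (ς ^ 2 * t, ς • x) (2 * (ς ^ 2 * t), ς • x)
  have hIcc : Icc (1 : ℝ) c ⊆ Ioi 0 := fun ς hς => lt_of_lt_of_le one_pos hς.1
  have hcont : ContinuousOn g (Icc 1 c) := (gkCurve_continuousOn_deriv u hu ht x).mono hIcc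
  have hderiv : ∀ ς ∈ uIcc (1 : ℝ) c,
      HasDerivAt (fun σ : ℝ => σ • u (σ ^ 2 * t) (σ • x)) (g ς) ς := by
    intro ς hς
    rw [uIcc_of_le hc] at hς
    exact gkCurve_hasDerivAt u hu ht x (hIcc hς)
  have hint : IntervalIntegrable g volume 1 c := by
    refine ContinuousOn.intervalIntegrable ?_
    rwa [uIcc_of_le hc]
  -- fundamental theorem of calculus on `[1, c]`
  have hFTC := intervalIntegral.integral_eq_sub_of_hasDerivAt hderiv hint
  rw [intervalIntegral.integral_of_le hc] at hFTC
  have hdiff : nsRescale c u t x - u t x = ∫ ς in Ioc 1 c, g ς := by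
    rw [hFTC, nsRescale_apply]
    simp
  -- measurability of the integrand on `[1, c]`
  have hmeas : AEMeasurable (fun ς => ‖g ς‖ₑ) (volume.restrict (Icc 1 c)) :=
    (continuous_enorm.comp_continuousOn hcont).aemeasurable measurableSet_Icc
  calc ‖nsRescale c u t x - u t x‖ₑ ^ 2
      = ‖∫ ς in Ioc 1 c, g ς‖ₑ ^ 2 := by rw [hdiff]
    _ ≤ (∫⁻ ς in Ioc 1 c, ‖g ς‖ₑ) ^ 2 := by
        gcongr
        exact enorm_integral_le_lintegral_enorm _
    _ = (∫⁻ ς in Icc 1 c, ‖g ς‖ₑ) ^ 2 := by rw [restrict_Ioc_eq_restrict_Icc]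
    _ ≤ volume.restrict (Icc (1 : ℝ) c) univ * ∫⁻ ς in Icc 1 c, ‖g ς‖ₑ ^ 2 :=
        PoincareBall.sq_lintegral_le_measure_mul_lintegral_sq _ hmeas
    _ = ENNReal.ofReal (c - 1) * ∫⁻ ς in Icc 1 c, ‖g ς‖ₑ ^ 2 := by
        rw [Measure.restrict_apply_univ, Real.volume_Icc]

/-- **Increment along the scaling curve** (registered stub S2a of line `Sketch`, skeleton v6, the
signature verbatim).  For `u` of class `C¹` on the open slab, `t < 0`, `x` and `c ≥ 1`, the curve
`γ(ς) = ς u(ς²t, ςx)` has `γ'(ς) = u(τ,y) + D(uncurry u)(τ,y)[(2τ, y)]` at `(τ,y) = (ς²t, ςx)`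
(twice the scaling defect), so
`‖c u(c²t,cx) − u(t,x)‖² ≤ (c − 1) ∫_{1}^{c} ‖γ'(ς)‖² dς` (fundamental theorem of calculus and
Cauchy–Schwarz; `gkCurve_enorm_sq_le` with `E = F = ℝ³`). [folklore] -/
theorem stub_gkScalingCurve :
    ∀ (u : ℝ → EuclideanSpace ℝ (Fin 3) → EuclideanSpace ℝ (Fin 3)),
      ContDiffOn ℝ 1 (uncurry u) (Iio (0 : ℝ) ×ˢ univ) →
      ∀ (t : ℝ), t < 0 → ∀ (x : EuclideanSpace ℝ (Fin 3)) (c : ℝ), 1 ≤ c →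
        ‖nsRescale c u t x - u t x‖ₑ ^ 2 ≤
          ENNReal.ofReal (c - 1) * ∫⁻ ς in Icc (1 : ℝ) c,
            ‖u (ς ^ 2 * t) (ς • x) +
              fderiv ℝ (uncurry u) (ς ^ 2 * t, ς • x) (2 * (ς ^ 2 * t), ς • x)‖ₑ ^ 2 :=
  fun u hu _t ht x _c hc => gkCurve_enorm_sq_le u hu ht x hc

end Summit.NavierStokesRegularity.NavierStokesRegularity.Theorems

end
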